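import Summits.Ventures.AbcSig.Rows.XTemplateB
import Summits.Ventures.AbcSig.Rows.TemplateC2a

/-!
# Venture AbcSig — ROW TEMPLATE for the C2c cells `A xⁿ + B yⁿ = 2 z²`, `A·B = ℓ^m` ([BS04, Thm. 1.4] shape; case (ii)_C, level `2⁸·ℓ`)

HONEST FRAMING. Fully PROVED template theorem of a COMPUTATION cell (`pub-abcsig`); CONDITIONAL on named hypotheses,
no claim on ABC or any summit. For an odd prime `ℓ`, `B = ℓ^m = 2⁰·ℓ^m` and `C = 2`, a primitive solution of
`xⁿ + ℓ^m yⁿ = 2 z²` has `x`, `y` odd (if one were even the left side would be odd, the right side is even), so by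
[BS04, Lemma 2.1/3.2] it falls in case (ii) with `ord₂(C) = 1` (`FreyCase.iiC` of `Recipes/BS04.lean`, `2`-exponent `8`)
at the single level `N = 2⁸ · ℓ = 256ℓ` (the odd part of the level ignores the prime `2 ∣ C`; [BS04, §5]: `C = 2`,
`AB = ℓ^m`, levels `256ℓ`). GIVEN, for the exponent `n` (prime, `≥ 7`, `n ≠ ℓ`, `m < n` = RULING H1 reduced exponent):
`BS04Package M` (cited), `DataComplete M (256ℓ) orbits` (computed) and per orbit a kernel certificate, a cited
exclusion for the family `famC2c ℓ m n` or an `ExcludesStd` discharge, the conclusion is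
`¬ IsPrimitiveSolution 1 (2⁰·ℓ^m) 2 n x y z` for `x·y ≠ ±1`; the second distribution `(ℓ^m, 1)` follows by
`IsPrimitiveSolution.swap`. p1's census predicate `Rows.C2cCell` quantifies over `n ∤ m` (unreduced); rows built on this
template state the reduced range `m < n` and say so.

* `bs04OddLevel_C_two` — the odd part of the Serre level does not see `C = 2`: `bs04OddLevel A B 2 n = bs04OddLevel A B 1 n`;
* `odd_xy_of_C_two` — `x`, `y` are odd when `A`, `B` are odd and `C = 2`;
* `xrow_template_C2c`, `xrow_template_C2c_swap` — the row shapes (via `xno_solution_in_case` of `Rows/XTemplateB.lean`).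

Reference: [BS04] M. A. Bennett, C. M. Skinner, Canad. J. Math. 56 (2004) 23–54, §§2–5 (cases (i)–(v), Lemma 3.2, Thm 1.4).
-/

namespace Summit.Ventures.AbcSig

/-- Family predicate of the C2c rows: coefficients `(1, 2⁰·ℓ^m, 2)`, exponent `n`. -/
def famC2c (ℓ m n : ℕ) : FreyDatum → Prop := fun S => S.A = 1 ∧ S.B = 2 ^ 0 * ℓ ^ m ∧ S.C = 2 ∧ S.n = n

/-- The odd part of the Serre level ignores `C = 2`: `bs04OddLevel A B 2 n = bs04OddLevel A B 1 n`. -/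
theorem bs04OddLevel_C_two (A B n : ℕ) : bs04OddLevel A B 2 n = bs04OddLevel A B 1 n := by
  have h2 : (2 : ℕ).primeFactors.filter (fun p => p ≠ 2 ∧ p ≠ n) = ∅ := by
    ext p
    simp only [Nat.prime_two.primeFactors, Finset.mem_filter, Finset.mem_singleton, Finset.notMem_empty, iff_false,
      not_and, not_not]
    intro hp h2
    exact absurd hp h2
  simp only [bs04OddLevel, h2, Nat.primeFactors_one, Finset.filter_empty, Finset.prod_empty]

/-- Level for `(1, 2⁰·ℓ^m, 2)` in case (ii)_C: `2⁸ · ℓ = 256ℓ`. -/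
theorem bs04Level_C2c (ℓ m n : ℕ) (hℓ : ℓ.Prime) (hℓ2 : ℓ ≠ 2) (hm : 1 ≤ m) (hn : n ≠ ℓ) :
    bs04Level .iiC 1 (2 ^ 0 * ℓ ^ m) 2 n = 256 * ℓ := by
  rw [bs04Level, bs04OddLevel_C_two, (bs04OddLevel_twoPow_primePow ℓ 0 m n hℓ hℓ2 hm hn).1]
  norm_num [FreyCase.twoExp]

/-- A primitive solution of `A xⁿ + B yⁿ = 2 z²` with `A`, `B` odd (`n ≥ 1`) has `x·y` odd. -/
theorem odd_xy_of_C_two {A B n : ℕ} {x y z : ℤ} (hA : Odd A) (hB : Odd B) (hn : 1 ≤ n)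
    (h : IsPrimitiveSolution A B 2 n x y z) : ¬ 2 ∣ x * y := by
  intro h2
  obtain ⟨heq, -, -, -, hab, -, -⟩ := h
  have hrhs : (2 : ℤ) ∣ (A : ℤ) * x ^ n + (B : ℤ) * y ^ n := by
    rw [heq]; push_cast; exact Dvd.dvd.mul_right (dvd_refl 2) _
  have hA2 : ¬ (2 : ℤ) ∣ (A : ℤ) := by
    intro hd; obtain ⟨k, hk⟩ := hA; omega
  have hB2 : ¬ (2 : ℤ) ∣ (B : ℤ) := by
    intro hd; obtain ⟨k, hk⟩ := hB; omega
  rcases Int.prime_two.dvd_mul.mp h2 with hx | hy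
  · have h1 : (2 : ℤ) ∣ (A : ℤ) * x ^ n := Dvd.dvd.mul_left (dvd_pow hx (by omega)) _
    have hByn : (2 : ℤ) ∣ (B : ℤ) * y ^ n := (dvd_add_right h1).mp hrhs
    have hy : (2 : ℤ) ∣ y := by
      rcases Int.prime_two.dvd_mul.mp hByn with hB' | hyn
      · exact absurd hB' hB2
      · exact Int.prime_two.dvd_of_dvd_pow hyn
    have hu := hab.isUnit_of_dvd' (Dvd.dvd.mul_left hx _) (Dvd.dvd.mul_left hy _)
    rcases Int.isUnit_iff.mp hu with h | h <;> omega
  · have h1 : (2 : ℤ) ∣ (B : ℤ) * y ^ n := Dvd.dvd.mul_left (dvd_pow hy (by omega)) _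
    have hAxn : (2 : ℤ) ∣ (A : ℤ) * x ^ n := (dvd_add_left h1).mp hrhs
    have hx : (2 : ℤ) ∣ x := by
      rcases Int.prime_two.dvd_mul.mp hAxn with hA' | hxn
      · exact absurd hA' hA2
      · exact Int.prime_two.dvd_of_dvd_pow hxn
    have hu := hab.isUnit_of_dvd' (Dvd.dvd.mul_left hx _) (Dvd.dvd.mul_left hy _)
    rcases Int.isUnit_iff.mp hu with h | h <;> omega

/-- **Row template, C2c cell `xⁿ + ℓ^m yⁿ = 2 z²`** (`B` written `2⁰·ℓ^m` so that the arithmetic lemmas of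
`Rows/TemplateB.lean` apply verbatim). For an odd prime `ℓ`, a prime `n ≥ 7` with `n ≠ ℓ`, `1 ≤ m < n`, and the cell's
hypotheses at level `256ℓ` for this `n` (package; data; per orbit a kernel certificate, a cited exclusion for `famC2c ℓ m n`,
or an `ExcludesStd` discharge), there is no primitive solution with `x·y ≠ ±1`. -/
theorem xrow_template_C2c (ℓ : ℕ) (hℓ : ℓ.Prime) (hℓ2 : ℓ ≠ 2) (M : NewformModel) (hP : M.BS04Package)
    {orbs : List OrbitData} (hD : M.DataComplete (256 * ℓ) orbs) (n : ℕ) (hn : n.Prime) (h7 : 7 ≤ n) (hnℓ : n ≠ ℓ)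
    (m : ℕ) (hm : 1 ≤ m) (hmn : m < n)
    (hS : ∀ o ∈ orbs, (∀ e ∈ o.coeffs, e.ell.Prime ∧ e.ell ≠ 2 ∧ ¬ e.ell ∣ 256 * ℓ) ∧
      (o.Eliminated bs04Allowed n ∨ (M.Excludes (256 * ℓ) o (famC2c ℓ m n) ∨ M.ExcludesStd (256 * ℓ) o n)))
    (x y z : ℤ) (h1 : x * y ≠ 1) (h2 : x * y ≠ -1) : ¬ IsPrimitiveSolution 1 (2 ^ 0 * ℓ ^ m) 2 n x y z := by
  intro hsol
  have hB : 0 < 2 ^ 0 * ℓ ^ m := by have := hℓ.pos; positivity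
  have hBodd : Odd (2 ^ 0 * ℓ ^ m) := by
    rw [pow_zero, one_mul]
    exact (hℓ.odd_of_ne_two hℓ2).pow
  have hxy : ¬ 2 ∣ x * y := odd_xy_of_C_two odd_one hBodd (by omega) hsol
  have hord : OrdTwoEq (((2 : ℕ) : ℤ)) 1 := by
    refine ⟨⟨1, by norm_num⟩, ?_⟩
    rintro ⟨k, hk⟩
    push_cast at hk
    omega
  have hcase : FreyCase.Holds .iiC 1 (2 ^ 0 * ℓ ^ m) 2 n x y z := ⟨hxy, hord⟩
  have hn2 : n ≠ 2 := by omega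
  have hndvd : ¬ n ∣ 1 * (2 ^ 0 * ℓ ^ m) * 2 := by
    intro h
    have h' : n ∣ 2 ^ 1 * ℓ ^ m := by
      have : 1 * (2 ^ 0 * ℓ ^ m) * 2 = 2 ^ 1 * ℓ ^ m := by ring
      rwa [this] at h
    exact not_dvd_twoPow_primePow ℓ 1 m n hℓ hn hn2 hnℓ h'
  have hfree : ∀ q : ℕ, q.Prime → ¬ q ^ n ∣ 1 ∧ ¬ q ^ n ∣ 2 ^ 0 * ℓ ^ m := by
    intro q hq
    refine ⟨?_, nthPowerFree_twoPow_primePow ℓ 0 m n hℓ hℓ2 (by omega) hmn q hq⟩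
    intro h
    have h1' := Nat.dvd_one.mp h
    rw [Nat.pow_eq_one] at h1'
    rcases h1' with h1' | h1'
    · exact hq.one_lt.ne' h1'
    · omega
  exact xno_solution_in_case M hP ⟨1, 2 ^ 0 * ℓ ^ m, 2, n, x, y, z⟩ .iiC (256 * ℓ) one_pos hB two_pos
    Nat.squarefree_two hn h7 hndvd hfree hsol h1 h2 hcase (bs04Level_C2c ℓ m n hℓ hℓ2 hm hnℓ) hD
    (famC2c ℓ m n) ⟨rfl, rfl, rfl, rfl⟩ hS

/-- **Second distribution** `ℓ^m xⁿ + yⁿ = 2 z²`: the first with `x, y` swapped (`IsPrimitiveSolution.swap`). -/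
theorem xrow_template_C2c_swap (ℓ : ℕ) (hℓ : ℓ.Prime) (hℓ2 : ℓ ≠ 2) (M : NewformModel) (hP : M.BS04Package)
    {orbs : List OrbitData} (hD : M.DataComplete (256 * ℓ) orbs) (n : ℕ) (hn : n.Prime) (h7 : 7 ≤ n) (hnℓ : n ≠ ℓ)
    (m : ℕ) (hm : 1 ≤ m) (hmn : m < n)
    (hS : ∀ o ∈ orbs, (∀ e ∈ o.coeffs, e.ell.Prime ∧ e.ell ≠ 2 ∧ ¬ e.ell ∣ 256 * ℓ) ∧
      (o.Eliminated bs04Allowed n ∨ (M.Excludes (256 * ℓ) o (famC2c ℓ m n) ∨ M.ExcludesStd (256 * ℓ) o n)))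
    (x y z : ℤ) (h1 : x * y ≠ 1) (h2 : x * y ≠ -1) : ¬ IsPrimitiveSolution (2 ^ 0 * ℓ ^ m) 1 2 n x y z := by
  intro h
  exact xrow_template_C2c ℓ hℓ hℓ2 M hP hD n hn h7 hnℓ m hm hmn hS y x z (by rwa [mul_comm]) (by rwa [mul_comm]) h.swap

end Summit.Ventures.AbcSig
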